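/-
Copyright: the b2b-balaban T⁴-continuum CRUX team, row NE7b leaf lineage `t4-ne7b-formalise-leaf-02` (gen 134). Project licence.
-/
import Summits.QuantumFields.BalabanUV.T4Continuum.Spine.NE7b.TorusPlaquetteIncidence
import Mathlib.Algebra.Order.BigOperators.Group.Finset

/-!
# THE PLAQUETTE TERMS' DISPLACEMENT WITNESSES ON THE TORUS `(ℤ∕N)^d`: every bond of the plaquette `(x, μ < ν)` — `(x, μ), (x + e_μ, ν), (x + e_ν, μ), (x, ν)` —
# starts at a site one unit move (or none) away from the reference bond's site `x`: `b.1 = x + w⁺ − w⁻` with `w⁻ = 0`, `Σ w⁺ ≤ 1` — the `hdisp` letter of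
# `…TentPartitionTorus.hvar_tentZ_torus` ∕ `…TentPartitionFloor` for the curl terms with `D = 1` (row NE7b, node U5c; residual (R2′) family (2), letter (ℓ1);
# lattice-geometry bookkeeping)

Cell `pub-balaban`, sub-cell `t4`, spine estimate NE7b (`T4WeightBudget.RelWeightBound`; the cell's OWN estimate — NOT PRINTED in [Bałaban 1983–89],
NOT PROVED).  Crux-route work under `Spine/NE7b/`; NOTHING of Bałaban's is asserted; no `def`; zero `sorry`; no `T4Continuum/Support` leaf (FREEZE (0)).
Imports: this lineage's `…TorusPlaquetteIncidence` (the plaquette-to-bonds map `ι` by its characterising hypothesis `hι`) and Mathlib.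

WHY.  `…TentPartitionTorus.hvar_tentZ_torus` (TPTo) turns, per term `j`, a displacement witness `pt b = pt (ref j) + w⁺ − w⁻` with `Σw⁺ + Σw⁻ ≤ D` for every
bond `b ∈ inc j` into AFLP's term-variation letter `Λ = D√2∕L`; `…TentPartitionFloor` then closes the (h2) floor with the tent partition.  For the CURL terms
at k = 1 the terms are the plaquettes of the unit torus, `inc p = image (ι p)` (four bonds, `…AveragedCurlFormSplit.card_image_four_le`; `2(d−1)` plaquettes per
bond, `…TorusPlaquetteIncidence.card_plaquettes_through_bond_le`), bonds are read at their START site `pt = Prod.fst`, and the reference bond is `ι p 0 = (x, μ)`.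
THIS FILE supplies the witness with `D = 1`.

WHAT IS PROVED ([folklore]; `ι`, `hι` as in `…TorusPlaquetteIncidence`):
* §1 `plaquetteBonds_zero` (`ι (x, a) 0 = (x, μ)`), `fst_plaquetteBonds` (the start sites of the four bonds: `x`, `x + e_μ`, `x + e_ν`, `x`).
* §2 `eq_add_indicator` (`x + e_κ = x + ↑(𝟙_κ) − ↑0` with `𝟙_κ : Fin d → ℕ`, `Σ 𝟙_κ = 1`), **`exists_displacement_plaquetteBonds`** — TPTo's `hdisp` VERBATIM
  with `pt := Prod.fst`, `ref p := ι p 0`, `inc p := univ.image (ι p)`, `D := 1`; `add_single_eq_update` (`x + e_κ = update x κ (x κ + 1)`),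
  **`exists_unit_plaquetteBonds`** — TPTo's sharper `hunit` letter (reference site or ONE FORWARD unit move ⇒ `μ = 2^d`).
* §3 toy: `d = 2`, `N = 3`, the plaquette at `0` in the plane `(0, 1)` (`example` via §2).

NOT HERE (honest): the block-average terms' witnesses (`D ≤ d(L′−1)`-type), the local floors, anything of Bałaban's.
BY-NAME EFFECT ON THE WALL: NONE.  NE7b NOT PRINTED ∕ NOT PROVED; spine PROVED 0∕9; rung (B)+1 on ONE finite T⁴ — NOT infinite volume, NOT the mass gap, NOT Clay.
HONEST DEPENDENCY: continuum YM on T⁴ ⇐ BetaPertH ∧ nine spine estimates (0/9 proved); BetaPertH ⇐ (D1) ∧ (D4) ∧ CAP+tail; G-an2-4 gates asym, D1 and NE2/3/4.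
-/

set_option autoImplicit false

open Finset

namespace Summit.QuantumFields.BalabanUV.T4Continuum.NE7b.PlaquetteTermDisplacement

variable {d N : ℕ}

/-! ## §1 The reference bond and the start sites of a plaquette's bonds -/

/-- The reference bond of the plaquette `(x, μ < ν)` is `ι (x, a) 0 = (x, μ)`. [folklore] -/
theorem plaquetteBonds_zero
    (ι : (Fin d → ZMod N) × {a : Fin d × Fin d // a.1 < a.2} → Fin 4 → (Fin d → ZMod N) × Fin d)
    (hι : ∀ x a, ι (x, a) = ![(x, a.1.1), (x + Pi.single a.1.1 1, a.1.2), (x + Pi.single a.1.2 1, a.1.1), (x, a.1.2)])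
    (x : Fin d → ZMod N) (a : {a : Fin d × Fin d // a.1 < a.2}) : ι (x, a) 0 = (x, a.1.1) := by
  rw [hι]; rfl

/-- The start sites of the four bonds of the plaquette `(x, μ < ν)`: `x`, `x + e_μ`, `x + e_ν`, `x`. [folklore] -/
theorem fst_plaquetteBonds
    (ι : (Fin d → ZMod N) × {a : Fin d × Fin d // a.1 < a.2} → Fin 4 → (Fin d → ZMod N) × Fin d)
    (hι : ∀ x a, ι (x, a) = ![(x, a.1.1), (x + Pi.single a.1.1 1, a.1.2), (x + Pi.single a.1.2 1, a.1.1), (x, a.1.2)])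
    (x : Fin d → ZMod N) (a : {a : Fin d × Fin d // a.1 < a.2}) (k : Fin 4) :
    (ι (x, a) k).1 = x ∨ (ι (x, a) k).1 = x + Pi.single a.1.1 1 ∨ (ι (x, a) k).1 = x + Pi.single a.1.2 1 := by
  rw [hι]
  fin_cases k
  · exact Or.inl rfl
  · exact Or.inr (Or.inl rfl)
  · exact Or.inr (Or.inr rfl)
  · exact Or.inl rfl

/-! ## §2 The displacement witnesses with `D = 1` -/

/-- `x + e_κ = x + ↑(𝟙_κ) − ↑0` for the indicator `𝟙_κ ν = if ν = κ then 1 else 0 : ℕ`, and `Σ_ν 𝟙_κ ν + Σ_ν 0 ≤ 1`. [folklore] -/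
theorem eq_add_indicator (x : Fin d → ZMod N) (κ : Fin d) :
    x + Pi.single κ 1 = x + (fun ν => (((if ν = κ then 1 else 0 : ℕ)) : ZMod N)) - (fun ν => (((fun _ => (0 : ℕ)) ν : ℕ) : ZMod N)) ∧
      ∑ ν, (if ν = κ then 1 else 0 : ℕ) + ∑ ν : Fin d, (fun _ => (0 : ℕ)) ν ≤ 1 := by
  refine ⟨?_, ?_⟩
  · funext ν
    simp only [Pi.add_apply, Pi.sub_apply, Pi.single_apply, Nat.cast_ite, Nat.cast_one, Nat.cast_zero, sub_zero]
  · simp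

/-- **THE PLAQUETTE TERMS' DISPLACEMENT WITNESSES** — `…TentPartitionTorus.hvar_tentZ_torus`'s `hdisp` with `pt := Prod.fst`, `ref p := ι p 0`,
`inc p := univ.image (ι p)`, `D := 1`: every bond of a plaquette starts at the reference site `x` or one unit move `+e_μ` ∕ `+e_ν` away. [folklore] -/
theorem exists_displacement_plaquetteBonds
    (ι : (Fin d → ZMod N) × {a : Fin d × Fin d // a.1 < a.2} → Fin 4 → (Fin d → ZMod N) × Fin d)
    (hι : ∀ x a, ι (x, a) = ![(x, a.1.1), (x + Pi.single a.1.1 1, a.1.2), (x + Pi.single a.1.2 1, a.1.1), (x, a.1.2)]) :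
    ∀ p : (Fin d → ZMod N) × {a : Fin d × Fin d // a.1 < a.2}, ∀ b ∈ (univ.image (ι p)), ∃ wp wm : Fin d → ℕ,
      Prod.fst b = Prod.fst (ι p 0) + (fun ν => ((wp ν : ℕ) : ZMod N)) - (fun ν => ((wm ν : ℕ) : ZMod N)) ∧
        ∑ ν, wp ν + ∑ ν, wm ν ≤ 1 := by
  classical
  rintro ⟨x, a⟩ b hb
  obtain ⟨k, -, rfl⟩ := Finset.mem_image.mp hb
  rw [plaquetteBonds_zero ι hι x a]
  rcases fst_plaquetteBonds ι hι x a k with h | h | h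
  · refine ⟨fun _ => 0, fun _ => 0, ?_, by simp⟩
    rw [h]; funext ν; simp
  · exact ⟨_, _, h.trans (eq_add_indicator x a.1.1).1, (eq_add_indicator x a.1.1).2⟩
  · exact ⟨_, _, h.trans (eq_add_indicator x a.1.2).1, (eq_add_indicator x a.1.2).2⟩


/-- `x + e_κ = update x κ (x κ + 1)` — a forward unit move in `…TentPartitionTorus`'s `Function.update` form. [folklore] -/
theorem add_single_eq_update (x : Fin d → ZMod N) (κ : Fin d) : x + Pi.single κ 1 = Function.update x κ (x κ + 1) := by
  funext ν
  by_cases h : ν = κ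
  · subst h; simp
  · simp [h]

/-- **THE PLAQUETTE TERMS' UNIT-MOVE LETTER** — `…TentPartitionTorus.card_alive_on_term_tentZ_le_of_unit`'s `hunit` (⇒ `μ = 2^d`, and `hdisp` with
`D = 1` by `hdisp_of_unit`) with `pt := Prod.fst`, `ref p := ι p 0`, `inc p := univ.image (ι p)`: every bond of a plaquette starts at the reference site or
ONE FORWARD unit move from it. [folklore] -/
theorem exists_unit_plaquetteBonds
    (ι : (Fin d → ZMod N) × {a : Fin d × Fin d // a.1 < a.2} → Fin 4 → (Fin d → ZMod N) × Fin d)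
    (hι : ∀ x a, ι (x, a) = ![(x, a.1.1), (x + Pi.single a.1.1 1, a.1.2), (x + Pi.single a.1.2 1, a.1.1), (x, a.1.2)]) :
    ∀ p : (Fin d → ZMod N) × {a : Fin d × Fin d // a.1 < a.2}, ∀ b ∈ (univ.image (ι p)),
      Prod.fst b = Prod.fst (ι p 0) ∨ ∃ ν, Prod.fst b = Function.update (Prod.fst (ι p 0)) ν (Prod.fst (ι p 0) ν + 1) := by
  classical
  rintro ⟨x, a⟩ b hb
  obtain ⟨k, -, rfl⟩ := Finset.mem_image.mp hb
  rw [plaquetteBonds_zero ι hι x a]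
  rcases fst_plaquetteBonds ι hι x a k with h | h | h
  · exact Or.inl h
  · exact Or.inr ⟨a.1.1, h.trans (add_single_eq_update x a.1.1)⟩
  · exact Or.inr ⟨a.1.2, h.trans (add_single_eq_update x a.1.2)⟩

/-! ## §3 Toy: `d = 2`, `N = 3` -/

/- the plaquette-to-bonds map written out and the witness for its plaquette at `0` in the plane `(0, 1)`. -/
example : ∀ p : (Fin 2 → ZMod 3) × {a : Fin 2 × Fin 2 // a.1 < a.2},
    ∀ b ∈ (univ.image ((fun q : (Fin 2 → ZMod 3) × {a : Fin 2 × Fin 2 // a.1 < a.2} =>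
      ![(q.1, q.2.1.1), (q.1 + Pi.single q.2.1.1 1, q.2.1.2), (q.1 + Pi.single q.2.1.2 1, q.2.1.1), (q.1, q.2.1.2)]) p)),
      ∃ wp wm : Fin 2 → ℕ, Prod.fst b = Prod.fst ((fun q : (Fin 2 → ZMod 3) × {a : Fin 2 × Fin 2 // a.1 < a.2} =>
        ![(q.1, q.2.1.1), (q.1 + Pi.single q.2.1.1 1, q.2.1.2), (q.1 + Pi.single q.2.1.2 1, q.2.1.1), (q.1, q.2.1.2)]) p 0)
          + (fun ν => ((wp ν : ℕ) : ZMod 3)) - (fun ν => ((wm ν : ℕ) : ZMod 3)) ∧ ∑ ν, wp ν + ∑ ν, wm ν ≤ 1 :=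
  exists_displacement_plaquetteBonds _ fun _ _ => rfl

end Summit.QuantumFields.BalabanUV.T4Continuum.NE7b.PlaquetteTermDisplacement
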